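import Mathlib
import Summits.ResolutionOfSingularities.ResolutionOfSingularities.Theorems.RadicialJungCleanModelsLens5TFrameCurrency
import HarnessLib

/-!
# Route `RadicialJung`, crux `CleanModels` (stmt-15917): T⁗ port part 1/13 — §C residual gradedness RG (source `Lens5_TFrame.lean` :360–627)

PORT (line lead `res-B-lead-1` g8, for Sketch rev 32) of res-B-lens-5's crux workfiles `Cruxes/DescentPerfectToAll/Lens5_TFrame.lean` rev 4
(crux ae884a356928; author res-B-lens-5 g15; `lean check` rc 0 · 0 sorries · 0 warnings; crit-1 TRIAGE-146/150 PASS) and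
`Cruxes/DescentPerfectToAll/Lens5_PDegreeCount.lean` rev 3 (crux 100289d6413b; TRIAGE-151 PASS): THEOREMS T⁗ / T⁗′ / T⁗″ / T⁗‴ — the slice
{`[Γ:pΓ] = p²`, `k` of FINITE `p`-rank `r`, `[κ_v : κ_v^p] = p^r`} of the research stub `stub_cleanLU3DefectNonDiscrete` (valuations of MINIMAL
Frobenius defect `d(K|K^p, v) = p`, ANY such ground field: no perfectness, no separability of `K/k` or `κ_v/k`), modulo F-02 `CossartPiltant2019` and
F-32 (`hEmb`) only.  The port is split into def-free modules `…Lens5TFrame{RG,IR,Graded,Port2,Port4Core,Layer,Layer2,Port4,Composition,PMon,PDegreeA,PDegreeB,PDegreeC}`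
over ONE currency module `…Lens5TFrameCurrency` (the authors' `def`s, verbatim); declarations VERBATIM, namespace
`Summit.ResolutionOfSingularities.ResolutionOfSingularities.Theorems.RadicialJungCleanModels.Lens5TFrame` (the authors' §A copy of
`Lens5_PDegreeSep` and the constant-frame corollaries `cleanLU3DefectPRankTwoSepFin_of_frame` / `…SepFin_of_cossartPiltant2019'` are not ported).
OURS · counted 0 · nothing here proves resolution in characteristic `p`.


-/

set_option linter.dupNamespace false -- mandated namespace of this single-conjunct summit

section

open IsLocalRing
open Literature.AlgebraicGeometry.Resolution
open Summit.ResolutionOfSingularities.ResolutionOfSingularities.Theorems.RadicialJung.CleanModels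
open Summit.ResolutionOfSingularities.ResolutionOfSingularities.Theorems.RadicialJung.CleanModels.Lens5
open Summit.ResolutionOfSingularities.ResolutionOfSingularities.Theorems.RadicialJung.CleanModels.Lens5.PRankTwoCurrency
open Summit.ResolutionOfSingularities.ResolutionOfSingularities.Theorems.RadicialJung.CleanModels.Lens5.PRankTwoAssembly
open Summit.ResolutionOfSingularities.ResolutionOfSingularities.Theorems.RadicialJungCleanModels.Lens5RegularityCriterion
open Summit.ResolutionOfSingularities.ResolutionOfSingularities.Theorems.RadicialJungCleanModels.Lens5ChartSurjection

namespace Summit.ResolutionOfSingularities.ResolutionOfSingularities.Theorems.RadicialJungCleanModels.Lens5TFrame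

/-! ## §C The new valuation input: residual gradedness RG from immediate residues IR -/

/-- Residual `p`-independence makes `Θ` a unit of `v` (take `w = e₁`; `p ≥ 2`). [folklore] -/
theorem valuation_eq_one_of_residuallyPIndependent {p : ℕ} [Fact p.Prime] {K : Type} [Field K] (O : ValuationSubring K)
    (Θ : K) (hPI : ResiduallyPIndependent p O Θ) : O.valuation Θ = 1 := by
  classical
  have hp : p.Prime := Fact.out
  have h1 : (1 : ℕ) < p := hp.one_lt
  have h := hPI (Pi.single (⟨1, h1⟩ : Fin p) 1) (fun i => by
    by_cases hi : i = ⟨1, h1⟩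
    · subst hi; simp [O.one_mem]
    · simp [Pi.single_eq_of_ne hi, O.zero_mem]) ⟨⟨1, h1⟩, by simp⟩
  rw [Finset.sum_eq_single (⟨1, h1⟩ : Fin p)] at h
  · simpa using h
  · intro i _ hi; simp [Pi.single_eq_of_ne hi, zero_pow hp.ne_zero]
  · intro h0; exact absurd (Finset.mem_univ _) h0

/-- **RG (residual gradedness).**  If every unit of the subfield `M` is residually a `p`-th power (IR) and `1, Θ, …, Θ^{p-1}` are
residually `p`-independent, then `v(Σ_{i<p} c_i Θ^i) = max_i v(c_i)` for `c_i ∈ M`.  PROVED (normalise by the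
maximal coefficient, replace each `c_i/c_{i₀}` by a `p`-th power modulo `𝔪_v`, apply residual `p`-independence). [folklore] -/
theorem valuation_sum_mul_pow_eq_sup {p : ℕ} [Fact p.Prime] {K : Type} [Field K] (O : ValuationSubring K) (M : Subfield K)
    (hIR : ∀ m : K, m ∈ M → O.valuation m = 1 → ∃ w : K, O.valuation (m - w ^ p) < 1)
    (Θ : K) (hPI : ResiduallyPIndependent p O Θ) (c : Fin p → K) (hc : ∀ i, c i ∈ M) :
    O.valuation (∑ i : Fin p, c i * Θ ^ (i : ℕ)) = Finset.univ.sup (fun i => O.valuation (c i)) := by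
  classical
  have hp : p.Prime := Fact.out
  haveI : NeZero p := ⟨hp.ne_zero⟩
  have hΘv := valuation_eq_one_of_residuallyPIndependent O Θ hPI
  by_cases h0 : ∀ i, c i = 0
  · have hf : (fun i => O.valuation (c i)) = fun _ : Fin p => (0 : O.ValueGroup) := by
      funext i; rw [h0 i, map_zero]
    rw [hf, Finset.sup_const Finset.univ_nonempty]
    simp [h0]
  push Not at h0
  obtain ⟨i₁, hi₁⟩ := h0
  obtain ⟨i₀, -, hi₀⟩ := Finset.exists_max_image Finset.univ (fun i => O.valuation (c i)) ⟨i₁, Finset.mem_univ _⟩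
  have hsup : Finset.univ.sup (fun i => O.valuation (c i)) = O.valuation (c i₀) :=
    le_antisymm (Finset.sup_le fun i hi => hi₀ i hi) (Finset.le_sup (f := fun i => O.valuation (c i)) (Finset.mem_univ i₀))
  have hc0 : c i₀ ≠ 0 := by
    intro h
    have h1 := hi₀ i₁ (Finset.mem_univ _)
    rw [h, map_zero, le_zero_iff, map_eq_zero] at h1
    exact hi₁ h1
  set d : Fin p → K := fun i => c i / c i₀ with hd
  have hdM : ∀ i, d i ∈ M := fun i => div_mem (hc i) (hc i₀)
  have hvc0 : O.valuation (c i₀) ≠ 0 := by rwa [ne_eq, map_eq_zero]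
  have hdv : ∀ i, O.valuation (d i) ≤ 1 := fun i => by
    simp only [hd, map_div₀]
    exact div_le_one_of_le₀ (hi₀ i (Finset.mem_univ _)) zero_le
  have hdi₀ : d i₀ = 1 := div_self hc0
  -- each `d_i` is a `p`-th power modulo `𝔪_v` (IR for the units, `0` for the others)
  have hw : ∀ i, ∃ w : K, O.valuation (d i - w ^ p) < 1 := by
    intro i
    rcases (hdv i).lt_or_eq with hlt | heq
    · exact ⟨0, by rw [zero_pow hp.ne_zero, sub_zero]; exact hlt⟩
    · exact hIR (d i) (hdM i) heq
  choose w hw using hw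
  have hwO : ∀ i, w i ∈ O := by
    intro i
    rw [← O.valuation_le_one_iff]
    by_contra hgt
    push Not at hgt
    have hwp : 1 < O.valuation (w i ^ p) := by rw [map_pow]; exact one_lt_pow₀ hgt hp.ne_zero
    have hlt : O.valuation (d i) < O.valuation (w i ^ p) := lt_of_le_of_lt (hdv i) hwp
    have heq : O.valuation (d i - w i ^ p) = O.valuation (w i ^ p) := Valuation.map_sub_eq_of_lt_right _ hlt
    exact lt_irrefl _ ((heq ▸ hw i).trans hwp)
  have hwi₀ : O.valuation (w i₀) = 1 := by
    have h := hw i₀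
    rw [hdi₀] at h
    have h' : O.valuation (w i₀ ^ p - 1) < O.valuation (1 : K) := by
      rw [← Valuation.map_neg, neg_sub, map_one]; exact h
    have h1 : O.valuation (w i₀ ^ p) = 1 := by
      have := Valuation.map_eq_of_sub_lt _ h'
      rwa [map_one] at this
    rw [map_pow] at h1
    rcases pow_eq_one_iff.mp h1 with h | h
    · exact h
    · exact absurd h hp.ne_zero
  -- the decomposition `Σ d_i Θ^i = Σ w_i^p Θ^i + Σ (d_i - w_i^p) Θ^i`: a unit plus an element of `𝔪_v`
  have hsplit : ∑ i : Fin p, d i * Θ ^ (i : ℕ) =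
      ∑ i : Fin p, w i ^ p * Θ ^ (i : ℕ) + ∑ i : Fin p, (d i - w i ^ p) * Θ ^ (i : ℕ) := by
    rw [← Finset.sum_add_distrib]; exact Finset.sum_congr rfl fun i _ => by ring
  have h1 : O.valuation (∑ i : Fin p, w i ^ p * Θ ^ (i : ℕ)) = 1 := hPI w hwO ⟨i₀, hwi₀⟩
  have h2 : O.valuation (∑ i : Fin p, (d i - w i ^ p) * Θ ^ (i : ℕ)) < 1 := by
    refine Valuation.map_sum_lt _ one_ne_zero fun i _ => ?_
    rw [map_mul, map_pow, hΘv, one_pow, mul_one]; exact hw i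
  have hdsum : O.valuation (∑ i : Fin p, d i * Θ ^ (i : ℕ)) = 1 := by
    rw [hsplit, Valuation.map_add_eq_of_lt_left]
    · exact h1
    · rw [h1]; exact h2
  have hcsum : ∑ i : Fin p, c i * Θ ^ (i : ℕ) = c i₀ * ∑ i : Fin p, d i * Θ ^ (i : ℕ) := by
    rw [Finset.mul_sum]
    exact Finset.sum_congr rfl fun i _ => by simp only [hd]; rw [← mul_assoc, mul_div_cancel₀ _ hc0]
  rw [hcsum, map_mul, hdsum, mul_one, hsup]

/-- Residual `p`-independence of a family makes each member a `v`-unit (take `w = e_s`). [folklore] -/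
theorem valuation_eq_one_of_residuallyPIndependentFamily {p : ℕ} [Fact p.Prime] {K : Type} [Field K] (O : ValuationSubring K)
    {S : Type} [Fintype S] (B : S → K) (hPI : ResiduallyPIndependentFamily p O B) (s : S) : O.valuation (B s) = 1 := by
  classical
  have hp : p.Prime := Fact.out
  have h := hPI (Pi.single s 1) (fun t => by
    by_cases ht : t = s
    · subst ht; simp [O.one_mem]
    · simp [Pi.single_eq_of_ne ht, O.zero_mem]) ⟨s, by simp⟩
  rw [Finset.sum_eq_single s] at h
  · simpa using h
  · intro t _ ht; simp [Pi.single_eq_of_ne ht, zero_pow hp.ne_zero]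
  · intro h0; exact absurd (Finset.mem_univ _) h0

/-- **RG for a family (residual gradedness).**  If every unit of the subfield `M` is residually a `p`-th power (IR) and the finite family
`B` is residually `p`-independent, then `v(Σ_s c_s B_s) = max_s v(c_s)` for `c_s ∈ M`.  PROVED (as the power version). [folklore] -/
theorem valuation_sum_mul_family_eq_sup {p : ℕ} [Fact p.Prime] {K : Type} [Field K] (O : ValuationSubring K) (M : Subfield K)
    (hIR : ∀ m : K, m ∈ M → O.valuation m = 1 → ∃ w : K, O.valuation (m - w ^ p) < 1)
    {S : Type} [Fintype S] (B : S → K) (hPI : ResiduallyPIndependentFamily p O B) (c : S → K) (hc : ∀ i, c i ∈ M) :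
    O.valuation (∑ i : S, c i * B i) = Finset.univ.sup (fun i => O.valuation (c i)) := by
  classical
  have hp : p.Prime := Fact.out
  have hBv := valuation_eq_one_of_residuallyPIndependentFamily O B hPI
  by_cases h0 : ∀ i, c i = 0
  · have hsup0 : Finset.univ.sup (fun i => O.valuation (c i)) = 0 :=
      le_antisymm (Finset.sup_le fun i _ => by rw [h0 i, map_zero]) zero_le
    rw [hsup0]
    have : ∑ i : S, c i * B i = 0 := Finset.sum_eq_zero fun i _ => by rw [h0 i, zero_mul]
    rw [this, map_zero]
  push Not at h0
  obtain ⟨i₁, hi₁⟩ := h0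
  obtain ⟨i₀, -, hi₀⟩ := Finset.exists_max_image Finset.univ (fun i => O.valuation (c i)) ⟨i₁, Finset.mem_univ _⟩
  have hsup : Finset.univ.sup (fun i => O.valuation (c i)) = O.valuation (c i₀) :=
    le_antisymm (Finset.sup_le fun i hi => hi₀ i hi) (Finset.le_sup (f := fun i => O.valuation (c i)) (Finset.mem_univ i₀))
  have hc0 : c i₀ ≠ 0 := by
    intro h
    have h1 := hi₀ i₁ (Finset.mem_univ _)
    rw [h, map_zero, le_zero_iff, map_eq_zero] at h1
    exact hi₁ h1
  set d : S → K := fun i => c i / c i₀ with hd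
  have hdM : ∀ i, d i ∈ M := fun i => div_mem (hc i) (hc i₀)
  have hvc0 : O.valuation (c i₀) ≠ 0 := by rwa [ne_eq, map_eq_zero]
  have hdv : ∀ i, O.valuation (d i) ≤ 1 := fun i => by
    simp only [hd, map_div₀]
    exact div_le_one_of_le₀ (hi₀ i (Finset.mem_univ _)) zero_le
  have hdi₀ : d i₀ = 1 := div_self hc0
  have hw : ∀ i, ∃ w : K, O.valuation (d i - w ^ p) < 1 := by
    intro i
    rcases (hdv i).lt_or_eq with hlt | heq
    · exact ⟨0, by rw [zero_pow hp.ne_zero, sub_zero]; exact hlt⟩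
    · exact hIR (d i) (hdM i) heq
  choose w hw using hw
  have hwO : ∀ i, w i ∈ O := by
    intro i
    rw [← O.valuation_le_one_iff]
    by_contra hgt
    push Not at hgt
    have hwp : 1 < O.valuation (w i ^ p) := by rw [map_pow]; exact one_lt_pow₀ hgt hp.ne_zero
    have hlt : O.valuation (d i) < O.valuation (w i ^ p) := lt_of_le_of_lt (hdv i) hwp
    have heq : O.valuation (d i - w i ^ p) = O.valuation (w i ^ p) := Valuation.map_sub_eq_of_lt_right _ hlt
    exact lt_irrefl _ ((heq ▸ hw i).trans hwp)
  have hwi₀ : O.valuation (w i₀) = 1 := by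
    have h := hw i₀
    rw [hdi₀] at h
    have h' : O.valuation (w i₀ ^ p - 1) < O.valuation (1 : K) := by
      rw [← Valuation.map_neg, neg_sub, map_one]; exact h
    have h1 : O.valuation (w i₀ ^ p) = 1 := by
      have := Valuation.map_eq_of_sub_lt _ h'
      rwa [map_one] at this
    rw [map_pow] at h1
    rcases pow_eq_one_iff.mp h1 with h | h
    · exact h
    · exact absurd h hp.ne_zero
  have hsplit : ∑ i : S, d i * B i = ∑ i : S, w i ^ p * B i + ∑ i : S, (d i - w i ^ p) * B i := by
    rw [← Finset.sum_add_distrib]; exact Finset.sum_congr rfl fun i _ => by ring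
  have h1 : O.valuation (∑ i : S, w i ^ p * B i) = 1 := hPI w hwO ⟨i₀, hwi₀⟩
  have h2 : O.valuation (∑ i : S, (d i - w i ^ p) * B i) < 1 := by
    refine Valuation.map_sum_lt _ one_ne_zero fun i _ => ?_
    rw [map_mul, hBv i, mul_one]; exact hw i
  have hdsum : O.valuation (∑ i : S, d i * B i) = 1 := by
    rw [hsplit, Valuation.map_add_eq_of_lt_left]
    · exact h1
    · rw [h1]; exact h2
  have hcsum : ∑ i : S, c i * B i = c i₀ * ∑ i : S, d i * B i := by
    rw [Finset.mul_sum]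
    exact Finset.sum_congr rfl fun i _ => by simp only [hd]; rw [← mul_assoc, mul_div_cancel₀ _ hc0]
  rw [hcsum, map_mul, hdsum, mul_one, hsup]

/-- **Residual `p`-independence from a non-`p`-th-power residue.**  If the `v`-unit `m` is NOT congruent to a `p`-th power modulo
`𝔪_v`, then `1, m, …, m^{p-1}` are residually `p`-independent: in the residue field `κ` the class `m̄ ∉ κ^p` has minimal polynomial
`X^p - m̄^p` over `κ^p` (✓ `ImmediateValues.minpoly_eq_X_pow_sub_C` applied to the field `κ`), so no non-trivial `κ^p`-relation of
degree `< p` exists. [folklore] -/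
theorem residuallyPIndependent_of_not_residue_pthPower {p : ℕ} [Fact p.Prime] {K : Type} [Field K] [CharP K p]
    (O : ValuationSubring K) (m : K) (hvm : O.valuation m = 1) (H : ∀ w : K, 1 ≤ O.valuation (m - w ^ p)) :
    ResiduallyPIndependent p O m := by
  classical
  have hp : p.Prime := Fact.out
  intro w hwO hunit
  obtain ⟨i₁, hi₁⟩ := hunit
  -- the residue field `κ` of `O`, of characteristic `p`
  haveI hOchar : CharP O p := (O.subtype).charP Subtype.val_injective p
  haveI : CharP (IsLocalRing.ResidueField O) p :=
    (RingHom.charP_iff_charP ((IsLocalRing.residue O).comp (ZMod.castHom (dvd_refl p) O)) p).mp (ZMod.charP p)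
  have hmO : m ∈ O := (O.valuation_le_one_iff m).mp hvm.le
  set mO : O := ⟨m, hmO⟩ with hmOdef
  set wO : Fin p → O := fun i => ⟨w i, hwO i⟩ with hwOdef
  set mbar : IsLocalRing.ResidueField O := IsLocalRing.residue O mO with hmbar
  -- `m̄` is not a `p`-th power in `κ`
  have hmnp : ∀ c : IsLocalRing.ResidueField O, c ^ p ≠ mbar := by
    intro c hc
    obtain ⟨cO, rfl⟩ := IsLocalRing.residue_surjective c
    have h0 : IsLocalRing.residue O (mO - cO ^ p) = 0 := by rw [map_sub, map_pow, hc, hmbar, sub_self]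
    rw [IsLocalRing.residue_eq_zero_iff] at h0
    have hlt : O.valuation (((mO - cO ^ p : O)) : K) < 1 := (O.valuation_lt_one_iff _).mp h0
    have hlt' : O.valuation (m - (cO : K) ^ p) < 1 := by
      have : (((mO - cO ^ p : O)) : K) = m - (cO : K) ^ p := by rw [hmOdef]; push_cast; rfl
      rw [← this]; exact hlt
    exact absurd (H (cO : K)) (not_le.mpr hlt')
  -- the element `S = Σ w_i^p m^i ∈ O`; suppose `v S < 1`
  set SO : O := ∑ i : Fin p, wO i ^ p * mO ^ (i : ℕ) with hSOdef
  have hS : ((SO : O) : K) = ∑ i : Fin p, w i ^ p * m ^ (i : ℕ) := by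
    rw [hSOdef]; push_cast; rfl
  have hle : O.valuation (∑ i : Fin p, w i ^ p * m ^ (i : ℕ)) ≤ 1 := by
    rw [← hS]; exact (O.valuation_le_one_iff _).mpr SO.2
  by_contra hne
  have hlt : O.valuation (∑ i : Fin p, w i ^ p * m ^ (i : ℕ)) < 1 := lt_of_le_of_ne hle hne
  rw [← hS, ← O.valuation_lt_one_iff] at hlt
  have hres : IsLocalRing.residue O SO = 0 := (IsLocalRing.residue_eq_zero_iff _).mpr hlt
  have hsum : ∑ i : Fin p, IsLocalRing.residue O (wO i) ^ p * mbar ^ (i : ℕ) = 0 := by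
    rw [← hres, hSOdef, map_sum]
    exact Finset.sum_congr rfl fun i _ => by rw [map_mul, map_pow, map_pow, hmbar]
  -- the `κ^p`-polynomial of degree `< p` killing `m̄`
  set Fκ : Subfield (IsLocalRing.ResidueField O) := (frobenius (IsLocalRing.ResidueField O) p).fieldRange with hFκ
  let coef : Fin p → Fκ := fun i =>
    ⟨IsLocalRing.residue O (wO i) ^ p, RingHom.mem_fieldRange.mpr ⟨IsLocalRing.residue O (wO i), frobenius_def _ _⟩⟩
  set P : Polynomial Fκ := ∑ i : Fin p, Polynomial.C (coef i) * Polynomial.X ^ (i : ℕ) with hPdef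
  have hPeval : Polynomial.aeval mbar P = 0 := by
    rw [hPdef, map_sum]
    rw [← hsum]
    refine Finset.sum_congr rfl fun i _ => ?_
    rw [map_mul, map_pow, Polynomial.aeval_C, Polynomial.aeval_X]
    rfl
  have hcoef : ∀ i : Fin p, P.coeff (i : ℕ) = coef i := by
    intro i
    rw [hPdef, Polynomial.finsetSum_coeff]
    rw [Finset.sum_eq_single i]
    · rw [Polynomial.coeff_C_mul_X_pow, if_pos rfl]
    · intro j _ hji
      rw [Polynomial.coeff_C_mul_X_pow, if_neg]
      exact fun h => hji (Fin.ext h).symm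
    · intro h; exact absurd (Finset.mem_univ i) h
  have hP0 : P ≠ 0 := by
    intro h
    have h1 := hcoef i₁
    rw [h, Polynomial.coeff_zero] at h1
    have h2 : IsLocalRing.residue O (wO i₁) ^ p = 0 := by
      have := congrArg Subtype.val h1.symm
      simpa [coef] using this
    have h3 : IsLocalRing.residue O (wO i₁) = 0 := (pow_eq_zero_iff hp.ne_zero).mp h2
    rw [IsLocalRing.residue_eq_zero_iff] at h3
    have h4 : O.valuation ((wO i₁ : O) : K) < 1 := (O.valuation_lt_one_iff _).mp h3
    have : ((wO i₁ : O) : K) = w i₁ := rfl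
    rw [this, hi₁] at h4
    exact lt_irrefl _ h4
  have hPdeg : P.natDegree < p := by
    have hd : P.degree < p := by rw [hPdef]; exact Polynomial.degree_sum_fin_lt coef
    exact (Polynomial.natDegree_lt_iff_degree_lt hP0).mpr hd
  -- the minimal polynomial of `m̄` over `κ^p` has degree `p` and divides `P`: contradiction
  have hmin := ImmediateValues.minpoly_eq_X_pow_sub_C (p := p) mbar hmnp
  have hdvd := minpoly.dvd Fκ mbar hPeval
  have hdeg := Polynomial.natDegree_le_of_dvd hdvd hP0
  rw [hmin, Polynomial.natDegree_X_pow_sub_C] at hdeg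
  exact absurd hPdeg (not_lt.mpr hdeg)

end Summit.ResolutionOfSingularities.ResolutionOfSingularities.Theorems.RadicialJungCleanModels.Lens5TFrame

end
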